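import Summits.AnomalousDissipation.AnomalousDissipation.Theses.NeutralTaylorWaves
import Literature.Analysis.FluidPDE.SteadyNSLatticePersistenceDrift
import Literature.Analysis.FluidPDE.SteadyNSLatticeLinearised
import Literature.Analysis.FunctionSpaces.LatticeSobolevSmooth
import Literature.Analysis.FunctionSpaces.TorusVectorParseval

/-!
# Tools for the stub `stub_ellipticDensity` of the line `Sketch`
# (crux stmt-AnomalousDissipation-16315, `NeutralTaylorWaves.NewtonRealisation`)

Lattice ↔ physical-space dictionary on the state space `W ⊂ ℓ²(ℤ³; ℂ³)` of
`Literature.Analysis.FluidPDE.SteadyLattice` (`x ∈ W` represents `x̌ = 𝓕v`, `x(k) = |k|² v̂(k)`):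

* `gradNormSq_le_of_coeff_eq_cf` — the lattice Cauchy–Schwarz `‖∇v‖₂² = 4π² ∑|k|²‖x̌(k)‖² ≤ 4π²‖x̌‖‖x‖`;
* `norm_B_sq_le_integral`, `norm_D₃_sq_eq_integral` — `‖B(x, y)‖_W ≤ ‖(u·∇)v‖_{L²}`, `‖D₃x‖_W = ‖∂₃u‖_{L²}`
  when `x̌ = 𝓕u`, `y̌ = 𝓕v` (`mFourierCoeff_convect_real`, `‖Π_k‖ ≤ 1`, Parseval);
* `exists_truncSeq` — truncations to symmetric boxes stay in `W`, have finitely supported `x̌`, and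
  converge in `W` (density of the rapidly decaying elements).

References: R. Temam, *Navier–Stokes Equations* (1979), Ch. II §1; folklore.
-/

set_option linter.dupNamespace false

noncomputable section

open scoped BigOperators Topology ENNReal NNReal InnerProductSpace ComplexConjugate
open Filter Set Function MeasureTheory UnitAddTorus
open Literature.Analysis Literature.Analysis.FunctionSpaces Literature.Analysis.FunctionSpaces.Torus
open Literature.Analysis.FunctionSpaces.EuclideanSpace
open Literature.Analysis.FluidPDE.ScalarFourier
open Literature.Analysis.FluidPDE.SteadyLattice Literature.Analysis.FluidPDE.SteadyLatticeDrift

namespace Summit.AnomalousDissipation.AnomalousDissipation.Theorems.NewtonRealisation.EllipticDensity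

/-- The flat unit three-torus (local notation). -/
local notation "𝕋³" => UnitAddTorus (Fin 3)
/-- Velocity values (local notation). -/
local notation "E³" => EuclideanSpace ℝ (Fin 3)

/-- Square-summable families `ℤ³ → ℂ³` (local notation). -/
local notation "ℓ2" => lp (fun _ : Fin 3 → ℤ => EuclideanSpace ℂ (Fin 3)) 2
/-- The physical coefficients `x̌(k) = x(k)/|k|²` of a lattice family (local notation, = the frame's `cf`). -/
local notation:max "cf[" x "]" =>
  ((fun mm : Fin 3 → ℤ => (((freqNormSq mm)⁻¹ : ℝ) : ℂ)) • (x : (Fin 3 → ℤ) → EuclideanSpace ℂ (Fin 3)))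
/-- The coordinates of an element of `ℓ²` / of the state space (local notation). -/
local notation:max "cw[" x "]" => (((x : ℓ2)) : (Fin 3 → ℤ) → EuclideanSpace ℂ (Fin 3))
/-- The convective symbol `N(a, b)(k)` as a vector of `ℂ³` (local notation, = the frame's `nl`). -/
local notation:max "nl[" a "," b "]" k:max =>
  (WithLp.toLp 2 (fun pp : Fin 3 => transportSym (fun jj mm => (a : (Fin 3 → ℤ) → EuclideanSpace ℂ (Fin 3)) mm jj)
    (fun mm => (b : (Fin 3 → ℤ) → EuclideanSpace ℂ (Fin 3)) mm pp) k) : EuclideanSpace ℂ (Fin 3))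
/-- `k · v` for `k ∈ ℤ³`, `v ∈ ℂ³` (local notation, = the frame's `kdot`). -/
local notation:max "kdot[" k "," v "]" => (∑ jj : Fin 3, ((k jj : ℤ) : ℂ) * (v : EuclideanSpace ℂ (Fin 3)) jj)

/-! ## Lattice and Parseval tools -/

/-- **Lattice Cauchy–Schwarz for the gradient**: if the smooth real field `v` has coefficients
`𝓕v = x̌` for some `x ∈ ℓ²`, then `‖∇v‖₂² ≤ 4π² ‖x̌‖_{ℓ²} ‖x‖_{ℓ²}` (`‖∇v‖₂² = 4π² ∑ |k|² ‖x̌(k)‖²`,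
`|k|² ‖x̌(k)‖² = ‖x̌(k)‖ ‖x(k)‖`, Cauchy–Schwarz). [folklore] -/
theorem gradNormSq_le_of_coeff_eq_cf {v : 𝕋³ → E³} (hv : IsSmooth v) (x : ℓ2)
    (hvc : mFourierCoeff (complexify ∘ v) = cf[cw[x]]) :
    gradNormSq v ≤ 4 * Real.pi ^ 2 * (Real.sqrt (∑' k, ‖cf[cw[x]] k‖ ^ 2) * ‖x‖) := by
  have hsx : Summable fun k => ‖cw[x] k‖ ^ 2 := (l2_hasSum_norm_sq x).summable
  have hsc : Summable fun k => ‖cf[cw[x]] k‖ ^ 2 :=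
    Summable.of_nonneg_of_le (fun k => sq_nonneg _)
      (fun k => pow_le_pow_left₀ (norm_nonneg _) (norm_cf_le _ k) 2) hsx
  -- Cauchy–Schwarz
  have hCS : ∑' k, ‖cf[cw[x]] k‖ * ‖cw[x] k‖ ≤ Real.sqrt (∑' k, ‖cf[cw[x]] k‖ ^ 2) * ‖x‖ := by
    have h := Real.inner_le_Lp_mul_Lq_tsum_of_nonneg (f := fun k => ‖cf[cw[x]] k‖)
      (g := fun k => ‖cw[x] k‖) Real.HolderConjugate.two_two (fun k => norm_nonneg _)
      (fun k => norm_nonneg _) (by simpa [Real.rpow_two] using hsc) (by simpa [Real.rpow_two] using hsx)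
    have h' : ∑' k, ‖cf[cw[x]] k‖ * ‖cw[x] k‖ ≤
        (∑' k, ‖cf[cw[x]] k‖ ^ 2) ^ (1 / (2 : ℝ)) * (∑' k, ‖cw[x] k‖ ^ 2) ^ (1 / (2 : ℝ)) := by
      simpa [Real.rpow_two] using h
    rw [← Real.sqrt_eq_rpow, ← Real.sqrt_eq_rpow, ← l2_norm_sq_eq_tsum, Real.sqrt_sq (norm_nonneg _)] at h'
    exact h'
  -- termwise identity `|k|² ‖x̌ k‖² = ‖x̌ k‖ ‖x k‖`
  have hterm : ∀ k, freqNormSq k * ‖cf[cw[x]] k‖ ^ 2 = ‖cf[cw[x]] k‖ * ‖cw[x] k‖ := by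
    intro k
    by_cases hk : k = 0
    · subst hk
      rw [cf_zero, norm_zero]
      simp
    · have hf : freqNormSq k ≠ 0 := ne_of_gt (lt_of_lt_of_le one_pos (one_le_freqNormSq' hk))
      rw [norm_cf]
      field_simp
  have hsp : Summable fun k => ‖cf[cw[x]] k‖ * ‖cw[x] k‖ := by
    refine Summable.of_nonneg_of_le (fun k => mul_nonneg (norm_nonneg _) (norm_nonneg _))
      (fun k => ?_) ((hsc.add hsx).div_const 2)
    dsimp only
    nlinarith [sq_nonneg (‖cf[cw[x]] k‖ - ‖cw[x] k‖)]
  -- the spectral identity for `‖∇v‖₂²`, read in `ℝ`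
  have h := tsum_freqNormSq_mul_enorm_sq_mFourierCoeff_complexify hv
  rw [hvc] at h
  have h2 : ∑' k, ENNReal.ofReal (freqNormSq k) * ‖cf[cw[x]] k‖ₑ ^ 2 =
      ENNReal.ofReal (∑' k, ‖cf[cw[x]] k‖ * ‖cw[x] k‖) := by
    rw [ENNReal.ofReal_tsum_of_nonneg (fun k => mul_nonneg (norm_nonneg _) (norm_nonneg _)) hsp]
    refine tsum_congr fun k => ?_
    rw [← hterm k, ENNReal.ofReal_mul (freqNormSq_nonneg k), ← ofReal_norm,
      ← ENNReal.ofReal_pow (norm_nonneg _)]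
  rw [h2] at h
  have h3 : (4 * Real.pi ^ 2)⁻¹ * gradNormSq v = ∑' k, ‖cf[cw[x]] k‖ * ‖cw[x] k‖ :=
    (ENNReal.ofReal_eq_ofReal_iff (by positivity [gradNormSq_nonneg v])
      (tsum_nonneg fun k => mul_nonneg (norm_nonneg _) (norm_nonneg _))).1 h.symm
  have hpi : (0 : ℝ) < 4 * Real.pi ^ 2 := by positivity
  calc gradNormSq v = 4 * Real.pi ^ 2 * ((4 * Real.pi ^ 2)⁻¹ * gradNormSq v) := by field_simp
    _ ≤ 4 * Real.pi ^ 2 * (Real.sqrt (∑' k, ‖cf[cw[x]] k‖ ^ 2) * ‖x‖) := by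
        rw [h3]; exact mul_le_mul_of_nonneg_left hCS hpi.le

/-- **Parseval for `∂₃`**: `∑ₖ ‖2πi k₃ û(k)‖² = ∫ ‖∂₃u‖²` for a smooth real field `u`. [folklore] -/
theorem hasSum_norm_sq_drift_coeff {u : 𝕋³ → E³} (hu : IsSmooth u) :
    HasSum (fun k : Fin 3 → ℤ =>
      ‖(2 * Real.pi * Complex.I * ((k (2 : Fin 3) : ℤ) : ℂ)) • mFourierCoeff (complexify ∘ u) k‖ ^ 2)
      (∫ z, ‖Torus.partialDeriv (2 : Fin 3) u z‖ ^ 2) := by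
  have h := hasSum_sq_norm_mFourierCoeff_complexify ((hu.partialDeriv (2 : Fin 3)).memLp 2)
  have e : (complexify ∘ Torus.partialDeriv (2 : Fin 3) u : 𝕋³ → EuclideanSpace ℂ (Fin 3)) =
      Torus.partialDeriv (2 : Fin 3) (complexify ∘ u) := by
    funext z
    exact (partialDeriv_complexify_comp hu (2 : Fin 3) z).symm
  rw [e] at h
  simp_rw [mFourierCoeff_partialDeriv hu.complexify_comp] at h
  exact h

/-- A single directional energy is bounded by the full gradient norm: `∫‖∂ⱼu‖² ≤ ‖∇u‖₂²`. [folklore] -/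
theorem integral_partialDeriv_sq_le_gradNormSq {u : 𝕋³ → E³} (hu : IsSmooth u) (j : Fin 3) :
    ∫ z, ‖Torus.partialDeriv j u z‖ ^ 2 ≤ gradNormSq u := by
  unfold gradNormSq
  refine integral_mono (hu.partialDeriv j).norm_sq.integrable
    (integrable_finsetSum _ fun i _ => (hu.partialDeriv i).norm_sq.integrable) fun z => ?_
  exact Finset.single_le_sum (f := fun i => ‖Torus.partialDeriv i u z‖ ^ 2) (fun i _ => sq_nonneg _)
    (Finset.mem_univ j)

/-- `∫‖f‖² ≤ K²` on the probability space `T³` when `‖f‖ ≤ K` pointwise. [folklore] -/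
theorem integral_norm_sq_le_sq_of_norm_le {f : 𝕋³ → E³} (hf : IsSmooth f) {K : ℝ} (hK : ∀ z, ‖f z‖ ≤ K) :
    ∫ z, ‖f z‖ ^ 2 ≤ K ^ 2 := by
  calc ∫ z, ‖f z‖ ^ 2 ≤ ∫ _ : 𝕋³, K ^ 2 :=
        integral_mono hf.norm_sq.integrable (integrable_const _) fun z =>
          pow_le_pow_left₀ (norm_nonneg _) (hK z) 2
    _ = K ^ 2 := by rw [integral_const, probReal_univ, one_smul]

/-! ## The operators `B` and `D₃` read in physical space -/

section StateSpace

variable {W : Submodule ℝ ℓ2}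

/-- **`‖B(x, y)‖_W ≤ ‖(u·∇)v‖_{L²}`** when `x̌ = 𝓕u`, `y̌ = 𝓕v`: the coordinates of `B(x, y)` are
`Π_k N(û, v̂)(k) = Π_k 𝓕((u·∇)v)(k)` (`mFourierCoeff_convect_real`), `‖Π_k‖ ≤ 1`, Parseval. [folklore] -/
theorem norm_B_sq_le_integral {B : W → W → W}
    (hB : ∀ x y : W, cw[B x y] = fun k => FluidPDE.Torus.lerayCoeff k (nl[cf[cw[x]], cf[cw[y]]] k))
    (x y : W) {u v : 𝕋³ → E³} (hu : IsSmooth u) (hv : IsSmooth v)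
    (hx : cf[cw[x]] = mFourierCoeff (complexify ∘ u)) (hy : cf[cw[y]] = mFourierCoeff (complexify ∘ v)) :
    ‖B x y‖ ^ 2 ≤ ∫ z, ‖Torus.convect u v z‖ ^ 2 := by
  have h1 : HasSum (fun k => ‖cw[B x y] k‖ ^ 2) (‖B x y‖ ^ 2) := l2_hasSum_norm_sq _
  have h2 := hasSum_sq_norm_mFourierCoeff_complexify ((hu.convect hv).memLp 2)
  refine hasSum_le (fun k => ?_) h1 h2
  refine pow_le_pow_left₀ (norm_nonneg _) ?_ 2
  rw [hB]
  dsimp only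
  rw [hx, hy, mFourierCoeff_convect_real hu hv k]
  exact norm_lerayCoeff_le _ _

/-- **`‖D₃ x‖_W = ‖∂₃u‖_{L²}`** when `x̌ = 𝓕u`: the coordinates of `D₃ x` are `2πi k₃ û(k) = 𝓕(∂₃u)(k)`,
Parseval. [folklore] -/
theorem norm_D₃_sq_eq_integral {D₃ : W →L[ℝ] W}
    (hD₃ : ∀ x : W, cw[D₃ x] = fun k => (2 * Real.pi * Complex.I * ((k (2 : Fin 3) : ℤ) : ℂ)) • cf[cw[x]] k)
    (x : W) {u : 𝕋³ → E³} (hu : IsSmooth u) (hx : cf[cw[x]] = mFourierCoeff (complexify ∘ u)) :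
    ‖D₃ x‖ ^ 2 = ∫ z, ‖Torus.partialDeriv (2 : Fin 3) u z‖ ^ 2 := by
  have h1 : HasSum (fun k => ‖cw[D₃ x] k‖ ^ 2) (‖D₃ x‖ ^ 2) := l2_hasSum_norm_sq _
  rw [hD₃, hx] at h1
  exact h1.unique (hasSum_norm_sq_drift_coeff hu)

end StateSpace

/-! ## Density of the finitely supported elements of `W` -/

/-- **Truncations are dense in `W`**: every `x ∈ W` is the limit in `W` of a sequence `y_N ∈ W` with
rapidly decaying (indeed finitely supported) `y̌_N` — the truncations `𝟙_{K_N} x` to the symmetric boxes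
`K_N = {k : |kⱼ| ≤ N}` (zero mode, transversality and conjugate symmetry are preserved as `K_N = −K_N`;
`‖x − 𝟙_{K_N} x‖² = ∑_{k ∉ K_N} ‖x(k)‖² → 0`, a tail of a convergent series). [folklore] -/
theorem exists_truncSeq :
    ∀ {W : Submodule ℝ ℓ2}
      (hW : ∀ x : ℓ2, x ∈ W ↔ cw[x] 0 = 0 ∧ (∀ kk : Fin 3 → ℤ, kdot[kk, cw[x] kk] = 0) ∧ IsConjSymm cw[x])
      (x : W), ∃ y : ℕ → W, (∀ N, RapidDecay cf[cw[y N]]) ∧ Tendsto y atTop (𝓝 x) := by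
  intro W hW x
  classical
  -- the symmetric boxes
  set K : ℕ → Finset (Fin 3 → ℤ) := fun N => Fintype.piFinset fun _ : Fin 3 => Finset.Icc (-(N : ℤ)) N
    with hK
  have hKmem : ∀ N (k : Fin 3 → ℤ), k ∈ K N ↔ ∀ i, -(N : ℤ) ≤ k i ∧ k i ≤ N := by
    intro N k
    simp only [hK, Fintype.mem_piFinset, Finset.mem_Icc]
  have hKsymm : ∀ N (k : Fin 3 → ℤ), k ∈ K N ↔ -k ∈ K N := by
    intro N k
    rw [hKmem, hKmem]
    simp only [Pi.neg_apply]
    exact ⟨fun hk i => by have := hk i; omega, fun hk i => by have := hk i; omega⟩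
  have hKmono : Monotone K := by
    intro m n hmn k hk
    rw [hKmem] at hk ⊢
    intro i
    have := hk i
    have hmn' : (m : ℤ) ≤ n := by exact_mod_cast hmn
    omega
  have hKcov : ∀ k : Fin 3 → ℤ, ∃ N, k ∈ K N := by
    intro k
    refine ⟨(∑ i, |k i|).toNat, ?_⟩
    rw [hKmem]
    intro i
    have h1 : |k i| ≤ ∑ j, |k j| :=
      Finset.single_le_sum (f := fun j => |k j|) (fun j _ => abs_nonneg (k j)) (Finset.mem_univ i)
    have h2 : (∑ j, |k j| : ℤ) ≤ ((∑ j, |k j|).toNat : ℤ) := Int.self_le_toNat _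
    have h3 := neg_abs_le (k i)
    have h4 := le_abs_self (k i)
    omega
  -- the truncated families are in `W`
  have hmem : ∀ N, Memℓp (Lattice.trunc (K N) cw[x]) 2 := fun N =>
    memℓp_two_of_rapidDecay (Lattice.rapidDecay_trunc _ _)
  have hV : ∀ N, (Lattice.trunc (K N) cw[x] : (Fin 3 → ℤ) → EuclideanSpace ℂ (Fin 3)) 0 = 0 ∧
      (∀ kk : Fin 3 → ℤ, kdot[kk, Lattice.trunc (K N) cw[x] kk] = 0) ∧
      IsConjSymm (Lattice.trunc (K N) cw[x]) := by
    intro N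
    refine ⟨?_, fun kk => ?_, fun kk => ?_⟩
    · simp only [Lattice.trunc_apply]
      split_ifs
      · exact W_zero hW x
      · rfl
    · simp only [Lattice.trunc_apply]
      split_ifs
      · exact W_trans hW x kk
      · exact kdot_zero kk
    · simp only [Lattice.trunc_apply]
      by_cases hk : kk ∈ K N
      · rw [if_pos ((hKsymm N kk).1 hk), if_pos hk]
        exact W_conj hW x kk
      · rw [if_neg (fun h' => hk ((hKsymm N kk).2 h')), if_neg hk, conjVec_zero]
  let y : ℕ → W := fun N => ⟨⟨Lattice.trunc (K N) cw[x], hmem N⟩, (hW _).2 (hV N)⟩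
  have hy : ∀ N, cw[y N] = Lattice.trunc (K N) cw[x] := fun N => rfl
  refine ⟨y, fun N => ?_, ?_⟩
  · -- finitely supported, hence rapidly decaying
    rw [hy]
    have e : cf[Lattice.trunc (K N) cw[x]] = Lattice.trunc (K N) cf[cw[x]] := by
      funext k
      rw [cf_apply, Lattice.trunc_apply, Lattice.trunc_apply, cf_apply]
      split_ifs
      · rfl
      · rw [smul_zero]
    rw [e]
    exact Lattice.rapidDecay_trunc _ _
  · -- convergence: the tail of `∑ ‖x k‖²`
    have hnorm : ∀ N, ‖y N - x‖ ^ 2 = ∑' k : {k : Fin 3 → ℤ // k ∉ K N}, ‖cw[x] k‖ ^ 2 := by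
      intro N
      rw [norm_sub_rev, ← norm_coeW, l2_norm_sq_eq_tsum, coeW_sub, hy]
      have e : ∀ k, ‖(cw[x] - Lattice.trunc (K N) cw[x]) k‖ ^ 2 =
          ((↑(K N) : Set (Fin 3 → ℤ))ᶜ).indicator (fun k => ‖cw[x] k‖ ^ 2) k := by
        intro k
        by_cases hk : k ∈ K N
        · simp [Lattice.trunc, hk]
        · simp [Lattice.trunc, hk]
      rw [tsum_congr e, ← tsum_subtype]
      rfl
    have h0 := tendsto_tsum_compl_atTop_zero fun k : Fin 3 → ℤ => ‖cw[x] k‖ ^ 2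
    have h1 := h0.comp (tendsto_atTop_finset_of_monotone hKmono hKcov)
    have h2 : Tendsto (fun N => ‖y N - x‖ ^ 2) atTop (𝓝 0) := h1.congr fun N => (hnorm N).symm
    have h3 : Tendsto (fun N => ‖y N - x‖) atTop (𝓝 0) := by
      have := (Real.continuous_sqrt.tendsto 0).comp h2
      rw [Real.sqrt_zero] at this
      refine this.congr fun N => ?_
      show Real.sqrt (‖y N - x‖ ^ 2) = ‖y N - x‖
      exact Real.sqrt_sq (norm_nonneg _)
    exact tendsto_iff_norm_sub_tendsto_zero.2 h3

end Summit.AnomalousDissipation.AnomalousDissipation.Theorems.NewtonRealisation.EllipticDensity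

end
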